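import Mathlib.RingTheory.NoetherNormalization
import Literature.NumberTheory.Transcendental.TrdegZariskiDim
import Literature.NumberTheory.Transcendental.ZariskiDimBounds
import HarnessLib

/-!
# The least dimension of a ℚ-variety through a point is its transcendence degree (converse half)

Sequel to `TrdegZariskiDim.lean` (`trdeg_adjoin_lt_of_mem_of_zariskiDim_lt`: a point of a
ℚ-variety `W` with `zariskiDim ℂ W < d` has `trdeg_ℚ < d`). Here the converse:

* `exists_definedOver_mem_zariskiDim_le_trdeg` — every `P ∈ ℂ^ι` lies on some `W` defined over the
  prime field with `zariskiDim ℂ W ≤ trdeg_ℚ ℚ(P)`; hence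
  `exists_definedOver_mem_zariskiDim_lt_iff`: (∃ ℚ-variety `W ∋ P` with `zariskiDim ℂ W < d`) iff
  `trdeg_ℚ ℚ(P) < d`.
* `exists_mem_indepExpPoints_of_trdeg_lt_two` — a would-be counterexample to Schanuel at `n = 2`
  (`x` ℚ-linearly independent, `trdeg_ℚ ℚ(x, eˣ) < 2`) is a point of `indepExpPoints W` for some
  ℚ-defined `W ⊆ ℂ² × ℂ²` with `zariskiDim ℂ W < 2`; with `TrdegZariskiDim.lean`,
  `schanuelRank_two_iff_indepExpPoints_eq_empty`: **SC(2) ⟺ every such `W` has no ℚ-independent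
  exponential point**. The crux `SparsityTwo` of the Schanuel routes (finitely many instead of none)
  is thus literally "each ℚ-curve carries finitely many Schanuel counterexamples".

## Proof of the converse
Noether-normalise the coordinate ring `ℚ[X]/ker(aeval P) ⊇ ℚ[y₁, …, y_s]` (Mathlib
`exists_integral_inj_algHom_of_fg`). The monic integrality relation of each coordinate class over
`ℚ[y]`, read as a ℚ-polynomial `F_j = m_j(y(X); X_j)`, vanishes at `P`; the `F_j` cut out a
ℚ-variety `W ∋ P` on which every coordinate is integral over `ℂ[y(X)]`, so `zariskiDim ℂ W ≤ s`
(`zariskiDim_le_of_integral_gens`, `ZariskiDimBounds.lean`); and `y₁(P), …, y_s(P) ∈ ℚ(P)` are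
algebraically independent (`ℚ[X]/ker ↪ ℂ`), so `s ≤ trdeg_ℚ ℚ(P)`. No base change of Krull
dimension is used. Sorry-free; no named fact; the only `def` is the coefficient map
`ratToBot : ℚ →+* (⊥ : Subfield ℂ)`.

## References
* H. Matsumura, *Commutative Ring Theory*, CUP 1986, Thm 5.6 and §33 Lemma 2 (Noether
  normalisation; dimension = transcendence degree).
* D. Marker, *A remark on Zilber's pseudoexponentiation*, J. Symbolic Logic 71 (2006), §1.
-/

namespace Literature.NumberTheory.Transcendental

open MvPolynomial Complex

noncomputable section

variable {ι : Type} [Fintype ι]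

/-- The prime field of `ℂ` receives `ℚ`. [folklore] -/
def ratToBot : ℚ →+* (⊥ : Subfield ℂ) where
  toFun q := ⟨q, SubfieldClass.ratCast_mem _ q⟩
  map_one' := Subtype.ext (by simp)
  map_mul' a b := Subtype.ext (by simp)
  map_zero' := Subtype.ext (by simp)
  map_add' a b := Subtype.ext (by simp)

/-- Any two ring maps `ℚ → ℂ` agree, in particular `ℚ → ⊥ → ℂ` is the structure map. [folklore] -/
theorem algebraMap_comp_ratToBot :
    (algebraMap (⊥ : Subfield ℂ) ℂ).comp ratToBot = algebraMap ℚ ℂ :=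
  Subsingleton.elim _ _

omit [Fintype ι] in
/-- Evaluating a ℚ-polynomial after moving its coefficients into the prime field. [folklore] -/
theorem aeval_map_ratToBot (w : ι → ℂ) (f : MvPolynomial ι ℚ) :
    MvPolynomial.aeval w (MvPolynomial.map ratToBot f) = MvPolynomial.aeval w f := by
  rw [MvPolynomial.aeval_def, MvPolynomial.eval₂_map, algebraMap_comp_ratToBot, ← MvPolynomial.aeval_def]

/-- **A point lies on a ℚ-variety of dimension at most its transcendence degree**: for every
`P ∈ ℂ^ι` there is `W ∋ P` defined over the prime field with
`zariskiDim ℂ W ≤ trdeg_ℚ ℚ(P)`. With `trdeg_adjoin_lt_of_mem_of_zariskiDim_lt` this says: the least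
dimension of a ℚ-variety through `P` is exactly `trdeg_ℚ ℚ(P)`. (Proof: Noether-normalise the
coordinate ring `ℚ[P] ⊇ ℚ[y₁,…,y_s]`; the `n` monic integrality relations of the coordinates over
`ℚ[y]`, read as ℚ-polynomials `F_j(X) = m_j(y(X), X_j)`, cut out a `W ∋ P` on which every coordinate
is integral over `ℂ[y(X)]`, so `zariskiDim ℂ W ≤ s` (`zariskiDim_le_of_integral_gens`), while
`y₁(P),…,y_s(P) ∈ ℚ(P)` are algebraically independent, so `s ≤ trdeg_ℚ ℚ(P)`.) [folklore] -/
theorem exists_definedOver_mem_zariskiDim_le_trdeg (P : ι → ℂ) :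
    ∃ W : Set (ι → ℂ), IsDefinedOver (⊥ : Subfield ℂ) W ∧ P ∈ W ∧
      zariskiDim ℂ W ≤
        (Cardinal.toNat (Algebra.trdeg ℚ ↥(IntermediateField.adjoin ℚ (Set.range P))) : WithBot ℕ∞) := by
  classical
  -- the coordinate ring `ℚ[X]/ker(aeval P) ≅ ℚ[P]`
  let φ : MvPolynomial ι ℚ →ₐ[ℚ] ℂ := MvPolynomial.aeval P
  let Ker : Ideal (MvPolynomial ι ℚ) := RingHom.ker φ
  haveI hker : Ker.IsPrime := RingHom.ker_isPrime _
  let Aq := MvPolynomial ι ℚ ⧸ Ker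
  haveI : IsDomain Aq := Ideal.Quotient.isDomain Ker
  -- Noether normalisation
  obtain ⟨s, g, hinj, hint⟩ := exists_integral_inj_algHom_of_fg ℚ Aq
  -- lift the images of the variables
  have hmk : Function.Surjective (Ideal.Quotient.mk Ker) := Ideal.Quotient.mk_surjective
  choose yt hyt using fun k : Fin s => hmk (g (X k))
  let B : MvPolynomial (Fin s) ℚ →ₐ[ℚ] MvPolynomial ι ℚ := MvPolynomial.aeval yt
  have hgB : g = (Ideal.Quotient.mkₐ ℚ Ker).comp B := by
    refine MvPolynomial.algHom_ext fun k => ?_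
    simp [B, hyt]
  -- the monic integrality relations of the coordinates over `ℚ[y]`
  have hrel : ∀ j : ι, ∃ m : Polynomial (MvPolynomial (Fin s) ℚ), m.Monic ∧
      MvPolynomial.aeval P (Polynomial.eval₂ B.toRingHom (X j) m) = 0 := by
    intro j
    obtain ⟨m, hm, hmj⟩ := hint (Ideal.Quotient.mk Ker (X j))
    refine ⟨m, hm, ?_⟩
    have h1 : Ideal.Quotient.mk Ker (Polynomial.eval₂ B.toRingHom (X j) m) = 0 := by
      rw [Polynomial.hom_eval₂, show (Ideal.Quotient.mk Ker).comp B.toRingHom = g.toRingHom by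
        rw [hgB]; rfl]
      exact hmj
    have h2 : Polynomial.eval₂ B.toRingHom (X j) m ∈ Ker := Ideal.Quotient.eq_zero_iff_mem.mp h1
    simpa [Ker, φ] using h2
  choose m hmonic hmP using hrel
  let F : ι → MvPolynomial ι ℚ := fun j => Polynomial.eval₂ B.toRingHom (X j) (m j)
  -- the ℚ-variety cut out by the relations
  let W : Set (ι → ℂ) := {w | ∀ j, MvPolynomial.aeval w (F j) = 0}
  refine ⟨W, ?_, fun j => hmP j, ?_⟩
  · refine isDefinedOver_bot_of_forall_iff W (Set.range fun j => MvPolynomial.map ratToBot (F j)) ?_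
    intro w
    simp only [W, Set.mem_setOf_eq, Set.forall_mem_range, aeval_map_ratToBot]
  -- dimension `≤ s`: every coordinate is integral over `ℂ[y(X)]` on `W`
  have hdimW : zariskiDim ℂ W ≤ s := by
    refine le_trans ?_ (le_of_eq (ringKrullDim_mvPolynomial_fin_complex s))
    refine zariskiDim_le_of_integral_gens W
      (fun k => MvPolynomial.map (algebraMap ℚ ℂ) (yt k)) fun j => ?_
    refine ⟨(m j).map (MvPolynomial.map (algebraMap ℚ ℂ)), (hmonic j).map _, fun w hw => ?_⟩
    -- both sides are `(m j).eval₂ E (w j)` for the same `E : ℚ[T_s] →+* ℂ`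
    have hE : (MvPolynomial.eval fun k => MvPolynomial.eval w (MvPolynomial.map (algebraMap ℚ ℂ) (yt k))).comp
        (MvPolynomial.map (algebraMap ℚ ℂ)) =
        (MvPolynomial.aeval w).toRingHom.comp B.toRingHom := by
      refine MvPolynomial.ringHom_ext (fun q => ?_) (fun k => ?_)
      · simp
      · simp only [RingHom.coe_comp, Function.comp_apply, MvPolynomial.map_X, MvPolynomial.eval_X,
          AlgHom.toRingHom_eq_coe, AlgHom.coe_toRingHom, B, MvPolynomial.aeval_X]
        rw [MvPolynomial.eval_map, ← MvPolynomial.aeval_def]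
    have hw' : MvPolynomial.aeval w (F j) = 0 := hw j
    rw [Polynomial.map_map, Polynomial.eval_map, hE]
    have h3 : MvPolynomial.aeval w (F j) =
        Polynomial.eval₂ ((MvPolynomial.aeval w).toRingHom.comp B.toRingHom) (w j) (m j) := by
      simp only [F]
      rw [show MvPolynomial.aeval w (Polynomial.eval₂ B.toRingHom (X j) (m j)) =
        (MvPolynomial.aeval w).toRingHom (Polynomial.eval₂ B.toRingHom (X j) (m j)) from rfl,
        Polynomial.hom_eval₂]
      simp
    rw [← h3, hw']
  -- `s ≤ trdeg_ℚ ℚ(P)`: the `y_k(P)` are algebraically independent elements of `ℚ(P)`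
  let E : IntermediateField ℚ ℂ := IntermediateField.adjoin ℚ (Set.range P)
  have hmemE : ∀ k : Fin s, MvPolynomial.aeval P (yt k) ∈ E := by
    intro k
    have : (MvPolynomial.aeval P).range ≤ E.toSubalgebra := by
      rw [← Algebra.adjoin_range_eq_range_aeval]
      exact IntermediateField.algebra_adjoin_le_adjoin ℚ _
    exact this ⟨yt k, rfl⟩
  let z : Fin s → E := fun k => ⟨MvPolynomial.aeval P (yt k), hmemE k⟩
  -- `ev : Aq → ℂ` injective with `ev ∘ g = aeval P ∘ yt` on variables
  let ev : Aq →ₐ[ℚ] ℂ := Ideal.Quotient.liftₐ Ker φ fun a ha => ha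
  have hev : Function.Injective ev := by
    rw [injective_iff_map_eq_zero]
    intro a ha
    obtain ⟨a, rfl⟩ := hmk a
    exact Ideal.Quotient.eq_zero_iff_mem.mpr ha
  have hz : AlgebraicIndependent ℚ z := by
    let v : E →ₐ[ℚ] ℂ := (algebraMap E ℂ).toRatAlgHom
    apply AlgebraicIndependent.of_comp v
    have hcomp : (v ∘ z) = ev ∘ g ∘ X := by
      funext k
      simp only [Function.comp_apply, v, z, RingHom.toRatAlgHom_apply]
      rw [← hyt k]
      rfl
    rw [hcomp]
    have hgX : AlgebraicIndependent ℚ (g ∘ X) := by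
      rw [algebraicIndependent_iff_injective_aeval]
      have : MvPolynomial.aeval (g ∘ X : Fin s → Aq) = g := MvPolynomial.algHom_ext fun k => by simp
      rw [this]
      exact hinj
    rw [algebraicIndependent_iff_injective_aeval] at hgX ⊢
    have : MvPolynomial.aeval (ev ∘ g ∘ X : Fin s → ℂ) = ev.comp (MvPolynomial.aeval (g ∘ X)) := by
      refine MvPolynomial.algHom_ext fun k => ?_
      simp
    rw [this, AlgHom.coe_comp]
    exact hev.comp hgX
  have hcard : Cardinal.mk (Fin s) ≤ Algebra.trdeg ℚ E := hz.cardinalMk_le_trdeg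
  obtain ⟨S, hS, halg⟩ := exists_finset_algebraicIndependent_maximal P
  have hfin : Algebra.trdeg ℚ E < Cardinal.aleph0 :=
    lt_of_le_of_lt (trdeg_adjoin_le_card P S halg) (Cardinal.natCast_lt_aleph0)
  have hs : s ≤ Cardinal.toNat (Algebra.trdeg ℚ E) := by
    simpa using Cardinal.toNat_le_toNat hcard hfin
  exact hdimW.trans (by exact_mod_cast hs)

/-- **The least dimension of a ℚ-variety through `P` is `trdeg_ℚ ℚ(P)`**: for `d : ℕ`, some `W ∋ P`
defined over the prime field has `zariskiDim ℂ W < d` iff `trdeg_ℚ ℚ(P) < d`. [folklore] -/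
theorem exists_definedOver_mem_zariskiDim_lt_iff (P : ι → ℂ) (d : ℕ) :
    (∃ W : Set (ι → ℂ), IsDefinedOver (⊥ : Subfield ℂ) W ∧ P ∈ W ∧ zariskiDim ℂ W < d) ↔
      Algebra.trdeg ℚ ↥(IntermediateField.adjoin ℚ (Set.range P)) < d := by
  constructor
  · rintro ⟨W, hW, hP, hd⟩
    exact trdeg_adjoin_lt_of_mem_of_zariskiDim_lt hW hP hd
  · intro h
    obtain ⟨W, hW, hP, hdim⟩ := exists_definedOver_mem_zariskiDim_le_trdeg P
    refine ⟨W, hW, hP, lt_of_le_of_lt hdim ?_⟩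
    have hfin : Algebra.trdeg ℚ ↥(IntermediateField.adjoin ℚ (Set.range P)) < Cardinal.aleph0 :=
      lt_of_lt_of_le h (le_of_lt Cardinal.natCast_lt_aleph0)
    have : Cardinal.toNat (Algebra.trdeg ℚ ↥(IntermediateField.adjoin ℚ (Set.range P))) < d := by
      have h' := h
      rw [← Cardinal.cast_toNat_of_lt_aleph0 hfin] at h'
      exact_mod_cast h'
    exact_mod_cast this

/-- **Schanuel counterexamples live on ℚ-curves**: a ℚ-linearly independent `x ∈ ℂ²` with
`trdeg_ℚ ℚ(x, eˣ) < 2` is a point of `indepExpPoints W` for some `W ⊆ ℂ² × ℂ²` defined over ℚ with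
`zariskiDim ℂ W < 2` — the objects counted by the crux `SparsityTwo` are exactly the would-be
counterexamples to Schanuel's conjecture at `n = 2`. [folklore] -/
theorem exists_mem_indepExpPoints_of_trdeg_lt_two {x : Fin 2 → ℂ} (hx : LinearIndependent ℚ x)
    (h : Algebra.trdeg ℚ ↥(IntermediateField.adjoin ℚ (Set.range x ∪ Set.range (cexp ∘ x))) < 2) :
    ∃ W : Set (Fin 2 ⊕ Fin 2 → ℂ), IsDefinedOver (⊥ : Subfield ℂ) W ∧ zariskiDim ℂ W < 2 ∧
      x ∈ indepExpPoints W := by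
  rw [← Set.Sum.elim_range] at h
  obtain ⟨W, hW, hP, hd⟩ :=
    (exists_definedOver_mem_zariskiDim_lt_iff (Sum.elim x (cexp ∘ x)) 2).mpr (by exact_mod_cast h)
  exact ⟨W, hW, by exact_mod_cast hd, hx, hP⟩

/-- **SC(2) in the language of the crux**: `SchanuelRank 2` holds iff every `W ⊆ ℂ² × ℂ²` defined
over ℚ with `zariskiDim ℂ W < 2` has NO ℚ-independent exponential point. (So the crux `SparsityTwo`
— finiteness instead of emptiness — is formally the weakening "each ℚ-curve carries finitely many
Schanuel counterexamples".) [folklore] -/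
theorem schanuelRank_two_iff_indepExpPoints_eq_empty :
    SchanuelRank 2 ↔ ∀ W : Set (Fin 2 ⊕ Fin 2 → ℂ), IsDefinedOver (⊥ : Subfield ℂ) W →
      zariskiDim ℂ W < 2 → indepExpPoints W = ∅ := by
  constructor
  · intro h W hW hd
    exact indepExpPoints_eq_empty_of_schanuelRank_two h hW hd
  · intro h y hy
    by_contra hlt
    rw [not_le] at hlt
    obtain ⟨W, hW, hd, hmem⟩ := exists_mem_indepExpPoints_of_trdeg_lt_two hy (by exact_mod_cast hlt)
    rw [h W hW hd] at hmem
    exact hmem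

end

end Literature.NumberTheory.Transcendental

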